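import Literature.MathematicalPhysics.QuantumLattice.HubbardFrameNormalisation
import Summits.HubbardSuperconductivity.HubbardSuperconductivity.Theorems.AposterioriOrderCriterionR.Negative.EmptyShell
import Summits.HubbardSuperconductivity.HubbardSuperconductivity.Theorems.AposterioriOrderCriterionR.Negative.FreeCoupling
import Summits.HubbardSuperconductivity.HubbardSuperconductivity.Theorems.AposterioriCapRgAposterioriOrderCriterionRFreeBridge

/-!
# Crux `AposterioriOrderCriterionR` (item `stmt-HubbardSuperconductivity-13884`): frame reduction of the `∀ K′` transfer stub

`--supports stmt-HubbardSuperconductivity-13884` helper of the line lead (seat c4); no definition, no `sorry`, no named fact.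
Every line of the crux quantifies its Grassmann → operator transfer stub over ADMISSIBLE EMPTY-SHELL FRAMES `K′`
(registered `stub_matsubaraBridge`, `stub_massiveEndgame`: `∀ K′, 0 < Λ′ → (∀ k, Λ′ ≤ |e_{K′}(k)|) → Tendsto (M ↦
scaleMeanFieldDensityCT L M β U μ h K′ Λ′) atTop (𝓝 …)`).  With the frame toolkit now in the Literature
(`HubbardCovarianceFrameResolvent`: `∫ dμ_{C^K} e^{−V_K} = Z_K ∫ dμ_C e^{−V}`; `HubbardFrameNormalisation`: `‖Z_K‖ = N^0/N^K`,
`freeLogDetCT K + log ‖Z^K_full‖ = freeLogDet + log ‖Z_full‖`) the frame drops out EXACTLY at finite `(L, M)`: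

* `mfFreeEnergyCT_of_emptyShell_eq_bare` — in an empty-shell frame, at zero twist, the scale-`Λ′` mean-field free energy IS the
  bare fully integrated finite-`M` grand potential `−(βL²)⁻¹[freeLogDet(μ′,h′) + log ‖∫ dμ_{C_{μ′,h′}} e^{−V}‖]` (wherever the
  latter's partition function is non-zero) — no `K′`, no `Λ′`;
* `scaleMeanFieldDensityCT_of_emptyShell_eq_bare`, `scaleCompressibilityCT_of_emptyShell_eq_bare` — hence the reported `m₀` and `κ`
  of every empty-shell frame are the `h′`- and `μ′`-derivatives of that one bare functional; `scaleMeanFieldDensityCT_emptyShell_frame_eq`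
  — two empty-shell frames report the same `m₀`;
* `tendsto_scaleMeanFieldDensityCT_of_emptyShell_of_bare` (`…_of_gapped_of_bare` for the un-normed shell hypothesis) — **the `∀ K′`
  transfer stub reduces to ONE bare statement**: if the bare finite-`M` anomalous density converges (to anything) as `M → ∞`, with the
  bare partition function eventually non-vanishing near `h`, then so does `scaleMeanFieldDensityCT … K′ Λ′` in every empty-shell
  frame, to the same limit;
* `scaleMeanFieldDensityCT_free_of_emptyShell`, `stub_matsubaraBridge_free` — at `U = 0` (where `Z_full = 1`) the registered stub
  therefore HOLDS IN EVERY EMPTY-SHELL FRAME `K′` (seat c3's `stub_matsubaraBridge_free_zero_frame` was the bare frame only): across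
  frames, too, the `μ ↦ μ + U/2` shift X1 of the bare bridge is the only obstruction.

So what a restated crux needs from the literature is exactly one fact about the BARE model: the Matsubara UV limit of
`−½ ∂_{h′}(−(βL²)⁻¹)[freeLogDet + log ‖Z_full‖]` (Pedra–Salmhofer 2008 Thm 4.5/§5; Giuliani–Mastropietro 2010 (2.6), App. A —
landing at the operator model `dWaveSourceTorus L U (μ + U/2) h`, crux workfile `BridgeInPrint.md`).
-/

noncomputable section

namespace Summit.HubbardSuperconductivity.HubbardSuperconductivity.Theorems

open Literature.MathematicalPhysics.QuantumLattice Literature.Probability.LatticeModels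
open Summit.HubbardSuperconductivity.HubbardSuperconductivity.Theorems.AposterioriOrderCriterionR.Negative
open Filter Finset Matrix
open scoped Topology

set_option linter.dupNamespace false

section EmptyShellFrame

variable {L M : ℕ} [NeZero L] {μ Λ₀ : ℝ} {K : TrigPolyC4v}

/-- **In an empty-shell frame the zero-twist mean-field free energy is the bare fully integrated grand potential**:
`f^{K}_MF(0, μ′, h′) = −(βL²)⁻¹ [freeLogDet(μ′, h′) + log ‖∫ dμ_{C_{μ′,h′}} e^{−V}‖]` for every `U, μ′, h′` at which the bare
finite-`M` partition function does not vanish (`β ≠ 0`): the frame's free determinant `N^K` and the normalisation `Z_K` of its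
counterterm cancel (`HubbardFrameNormalisation`), and nothing is below scale (`mfFreeEnergyCT_of_emptyShell`). [folklore] -/
theorem mfFreeEnergyCT_of_emptyShell_eq_bare (hΛ : 0 < Λ₀) (hshell : ∀ k : TorusSite 2 L, Λ₀ ≤ |nambuXiCT L μ K k|)
    {β : ℝ} (hβ : β ≠ 0) (U μ' h' : ℝ)
    (hZ : effPartitionFn ℂ (hubbardCovariance L M β μ' h') (hubbardInteraction L M β U) ≠ 0) :
    mfFreeEnergyCT L M β U μ K Λ₀ μ' h' 0 =
      -(1 / (β * (L : ℝ) ^ 2)) *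
        (freeLogDet L M β μ' h' 0 +
          Real.log ‖effPartitionFn ℂ (hubbardCovariance L M β μ' h') (hubbardInteraction L M β U)‖) := by
  rw [mfFreeEnergyCT_of_emptyShell hΛ hshell, deformedCovarianceCT_zero_twist,
    freeLogDetCT_add_log_norm_effPartitionFn_hubbardInteractionCT β μ' h' K hβ U hZ, freeLogDetCT_zero_frame]

/-- **The reported anomalous density of an empty-shell frame is the bare one**: if the bare finite-`M` partition function does
not vanish for `h′` near `h`, then `scaleMeanFieldDensityCT L M β U μ h K Λ₀ = −½ ∂_{h′}|_{h} (−(βL²)⁻¹)[freeLogDet(μ, h′) +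
log ‖∫ dμ_{C_{μ,h′}} e^{−V}‖]` — no `K`, no `Λ₀`. [folklore] -/
theorem scaleMeanFieldDensityCT_of_emptyShell_eq_bare (hΛ : 0 < Λ₀) (hshell : ∀ k : TorusSite 2 L, Λ₀ ≤ |nambuXiCT L μ K k|)
    {β : ℝ} (hβ : β ≠ 0) (U h : ℝ)
    (hZ : ∀ᶠ h' in 𝓝 h, effPartitionFn ℂ (hubbardCovariance L M β μ h') (hubbardInteraction L M β U) ≠ 0) :
    scaleMeanFieldDensityCT L M β U μ h K Λ₀ =
      -(1 / 2) * deriv (fun h' => -(1 / (β * (L : ℝ) ^ 2)) *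
        (freeLogDet L M β μ h' 0 +
          Real.log ‖effPartitionFn ℂ (hubbardCovariance L M β μ h') (hubbardInteraction L M β U)‖)) h := by
  rw [scaleMeanFieldDensityCT]
  congr 1
  refine Filter.EventuallyEq.deriv_eq ?_
  filter_upwards [hZ] with h' hh'
  exact mfFreeEnergyCT_of_emptyShell_eq_bare hΛ hshell hβ U μ h' hh'

/-- **The reported pair compressibility of an empty-shell frame is the bare one**: if the bare finite-`M` partition function does
not vanish for `μ′` near `μ`, then `scaleCompressibilityCT L M β U μ h K Λ₀ = −∂²_{μ′}|_{μ} (−(βL²)⁻¹)[freeLogDet(μ′, h) +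
log ‖∫ dμ_{C_{μ′,h}} e^{−V}‖]`. [folklore] -/
theorem scaleCompressibilityCT_of_emptyShell_eq_bare (hΛ : 0 < Λ₀) (hshell : ∀ k : TorusSite 2 L, Λ₀ ≤ |nambuXiCT L μ K k|)
    {β : ℝ} (hβ : β ≠ 0) (U h : ℝ)
    (hZ : ∀ᶠ μ' in 𝓝 μ, effPartitionFn ℂ (hubbardCovariance L M β μ' h) (hubbardInteraction L M β U) ≠ 0) :
    scaleCompressibilityCT L M β U μ h K Λ₀ =
      -iteratedDeriv 2 (fun μ' => -(1 / (β * (L : ℝ) ^ 2)) *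
        (freeLogDet L M β μ' h 0 +
          Real.log ‖effPartitionFn ℂ (hubbardCovariance L M β μ' h) (hubbardInteraction L M β U)‖)) μ := by
  have hfg : (fun μ' => mfFreeEnergyCT L M β U μ K Λ₀ μ' h 0) =ᶠ[𝓝 μ] fun μ' => -(1 / (β * (L : ℝ) ^ 2)) *
      (freeLogDet L M β μ' h 0 +
        Real.log ‖effPartitionFn ℂ (hubbardCovariance L M β μ' h) (hubbardInteraction L M β U)‖) := by
    filter_upwards [hZ] with μ' hμ'
    exact mfFreeEnergyCT_of_emptyShell_eq_bare hΛ hshell hβ U μ' h hμ'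
  rw [scaleCompressibilityCT, iteratedDeriv_succ, iteratedDeriv_one, iteratedDeriv_succ, iteratedDeriv_one]
  congr 1
  exact hfg.deriv.deriv_eq

/-- **Two empty-shell frames report the same anomalous density** (bare partition function non-vanishing near `h`): the `m₀`
coordinate of the CT report does not see the frame once the whole covariance is above scale. [folklore] -/
theorem scaleMeanFieldDensityCT_emptyShell_frame_eq {K₁ K₂ : TrigPolyC4v} {Λ₁ Λ₂ : ℝ}
    (hΛ₁ : 0 < Λ₁) (h₁ : ∀ k : TorusSite 2 L, Λ₁ ≤ |nambuXiCT L μ K₁ k|)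
    (hΛ₂ : 0 < Λ₂) (h₂ : ∀ k : TorusSite 2 L, Λ₂ ≤ |nambuXiCT L μ K₂ k|)
    {β : ℝ} (hβ : β ≠ 0) (U h : ℝ)
    (hZ : ∀ᶠ h' in 𝓝 h, effPartitionFn ℂ (hubbardCovariance L M β μ h') (hubbardInteraction L M β U) ≠ 0) :
    scaleMeanFieldDensityCT L M β U μ h K₁ Λ₁ = scaleMeanFieldDensityCT L M β U μ h K₂ Λ₂ := by
  rw [scaleMeanFieldDensityCT_of_emptyShell_eq_bare hΛ₁ h₁ hβ U h hZ, scaleMeanFieldDensityCT_of_emptyShell_eq_bare hΛ₂ h₂ hβ U h hZ]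

/-- **The `∀ K′` transfer stub reduces to one bare statement.**  If, as `M → ∞`, the bare finite-`M` partition function is
eventually non-vanishing near `h` and the bare anomalous density `−½ ∂_{h′}(−(βL²)⁻¹)[freeLogDet + log ‖Z_full‖]` converges to
`m`, then in EVERY empty-shell frame `K` (any `Λ₀ > 0` below its gap) `scaleMeanFieldDensityCT L M β U μ h K Λ₀ → m`. [folklore] -/
theorem tendsto_scaleMeanFieldDensityCT_of_emptyShell_of_bare (hΛ : 0 < Λ₀)
    (hshell : ∀ k : TorusSite 2 L, Λ₀ ≤ |nambuXiCT L μ K k|) {β : ℝ} (hβ : β ≠ 0) (U h : ℝ) {m : ℝ}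
    (hZ : ∀ᶠ M : ℕ in atTop, ∀ᶠ h' in 𝓝 h,
      effPartitionFn ℂ (hubbardCovariance L M β μ h') (hubbardInteraction L M β U) ≠ 0)
    (hbare : Tendsto (fun M : ℕ => -(1 / 2) * deriv (fun h' => -(1 / (β * (L : ℝ) ^ 2)) *
        (freeLogDet L M β μ h' 0 +
          Real.log ‖effPartitionFn ℂ (hubbardCovariance L M β μ h') (hubbardInteraction L M β U)‖)) h) atTop (𝓝 m)) :
    Tendsto (fun M : ℕ => scaleMeanFieldDensityCT L M β U μ h K Λ₀) atTop (𝓝 m) := by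
  refine hbare.congr' ?_
  filter_upwards [hZ] with M hM
  exact (scaleMeanFieldDensityCT_of_emptyShell_eq_bare hΛ hshell hβ U h hM).symm

/-- The same with the shell hypothesis in the un-normed form `Λ₀ ≤ e_K(k)` of the octave-recertification skeleton (a fully gapped
particle-like frame). [folklore] -/
theorem tendsto_scaleMeanFieldDensityCT_of_gapped_of_bare (hΛ : 0 < Λ₀)
    (hshell : ∀ k : TorusSite 2 L, Λ₀ ≤ nambuXiCT L μ K k) {β : ℝ} (hβ : β ≠ 0) (U h : ℝ) {m : ℝ}
    (hZ : ∀ᶠ M : ℕ in atTop, ∀ᶠ h' in 𝓝 h,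
      effPartitionFn ℂ (hubbardCovariance L M β μ h') (hubbardInteraction L M β U) ≠ 0)
    (hbare : Tendsto (fun M : ℕ => -(1 / 2) * deriv (fun h' => -(1 / (β * (L : ℝ) ^ 2)) *
        (freeLogDet L M β μ h' 0 +
          Real.log ‖effPartitionFn ℂ (hubbardCovariance L M β μ h') (hubbardInteraction L M β U)‖)) h) atTop (𝓝 m)) :
    Tendsto (fun M : ℕ => scaleMeanFieldDensityCT L M β U μ h K Λ₀) atTop (𝓝 m) :=
  tendsto_scaleMeanFieldDensityCT_of_emptyShell_of_bare hΛ (fun k => (hshell k).trans (le_abs_self _)) hβ U h hZ hbare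

/-! ### Zero coupling: the registered stub holds in every empty-shell frame -/

/-- At `U = 0` the bare finite-`M` partition function is `1`. [folklore] -/
theorem effPartitionFn_hubbardInteraction_free (β μ' h' : ℝ) :
    effPartitionFn ℂ (hubbardCovariance L M β μ' h') (hubbardInteraction L M β 0) = 1 := by
  rw [hubbardInteraction_zero_coupling, effPartitionFn_zero_interaction]

/-- **At `U = 0` every empty-shell frame reports the bare free anomalous density** (`β ≠ 0`):
`scaleMeanFieldDensityCT L M β 0 μ h K Λ₀ = scaleMeanFieldDensityCT L M β 0 μ h 0 Λ₀`
(`= (βL²)⁻¹ Σ_{ω,k} hφ_d²/(ω² + ξ² + h²φ_d²)`, `scaleMeanFieldDensityCT_free_zero_frame`). [folklore] -/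
theorem scaleMeanFieldDensityCT_free_of_emptyShell (hΛ : 0 < Λ₀) (hshell : ∀ k : TorusSite 2 L, Λ₀ ≤ |nambuXiCT L μ K k|)
    {β : ℝ} (hβ : β ≠ 0) (h : ℝ) :
    scaleMeanFieldDensityCT L M β 0 μ h K Λ₀ = scaleMeanFieldDensityCT L M β 0 μ h 0 Λ₀ := by
  rw [scaleMeanFieldDensityCT_of_emptyShell_eq_bare hΛ hshell hβ 0 h
      (Eventually.of_forall fun h' => by rw [effPartitionFn_hubbardInteraction_free]; exact one_ne_zero),
    scaleMeanFieldDensityCT_zero_frame, scaleMeanFieldDensity_free]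
  simp only [effPartitionFn_hubbardInteraction_free, norm_one, Real.log_one, add_zero]

/-- **The free Matsubara bridge in every empty-shell frame** (`L ≥ 3`, `β > 0`): at `U = 0`,
`scaleMeanFieldDensityCT L M β 0 μ h K Λ₀ → Re⟨Δ_d⟩_{β, dWaveSourceTorus L 0 μ h}/L²` as `M → ∞` (seat c3's
`tendsto_scaleMeanFieldDensityCT_free_bridge` transported from the bare frame by the frame reduction). [folklore] -/
theorem tendsto_scaleMeanFieldDensityCT_free_bridge_of_emptyShell (hL : 3 ≤ L) {β : ℝ} (hβ : 0 < β) (h : ℝ)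
    (hΛ : 0 < Λ₀) (hshell : ∀ k : TorusSite 2 L, Λ₀ ≤ |nambuXiCT L μ K k|) :
    Tendsto (fun M : ℕ => scaleMeanFieldDensityCT L M β 0 μ h K Λ₀) atTop
      (𝓝 ((gibbsState β (dWaveSourceTorus L 0 μ h) (pairField dWaveFormFactor L)).re / (L : ℝ) ^ 2)) := by
  have hfun : (fun M : ℕ => scaleMeanFieldDensityCT L M β 0 μ h K Λ₀) = fun M : ℕ => scaleMeanFieldDensityCT L M β 0 μ h 0 Λ₀ :=
    funext fun M => scaleMeanFieldDensityCT_free_of_emptyShell hΛ hshell hβ.ne' h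
  rw [hfun]
  exact tendsto_scaleMeanFieldDensityCT_free_bridge hL hβ μ h Λ₀

end EmptyShellFrame

/-- **Registered stub `stub_frameReduction` of the crux** (frame reduction of `stub_matsubaraBridge`): in every empty-shell frame
`K′` the `∀ K′` transfer stub follows from ONE statement about the bare model — eventual non-vanishing of the bare finite-`M`
partition function near `h` and convergence of the bare finite-`M` anomalous density. [folklore] -/
theorem stub_frameReduction : ∀ (L : ℕ) [NeZero L] (β U μ h Λ' m : ℝ) (K' : TrigPolyC4v), β ≠ 0 → 0 < Λ' → (∀ k : TorusSite 2 L, Λ' ≤ |nambuXiCT L μ K' k|) → (∀ᶠ M : ℕ in atTop, ∀ᶠ h' in 𝓝 h, effPartitionFn ℂ (hubbardCovariance L M β μ h') (hubbardInteraction L M β U) ≠ 0) → Tendsto (fun M : ℕ => -(1 / 2) * deriv (fun h' => -(1 / (β * (L : ℝ) ^ 2)) * (freeLogDet L M β μ h' 0 + Real.log ‖effPartitionFn ℂ (hubbardCovariance L M β μ h') (hubbardInteraction L M β U)‖)) h) atTop (𝓝 m) → Tendsto (fun M : ℕ => scaleMeanFieldDensityCT L M β U μ h K' Λ') atTop (𝓝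 m) :=
  fun _ _ _ U _ h _ _ _ hβ hΛ hshell hZ hbare => tendsto_scaleMeanFieldDensityCT_of_emptyShell_of_bare hΛ hshell hβ U h hZ hbare

/-- **The registered transfer stub at zero coupling, in every frame.**  `stub_matsubaraBridge` of the crux's skeletons
(grassmann-ward-flow / octave-recertification / cauchy-griffiths: `∀ K′`, empty shell `Λ′ ≤ |e_{K′}|`), instantiated at `U = 0`:
TRUE for every frame `K′` (seat c3 had the bare frame `K′ = 0`).  For `U ≠ 0` the same text is false at the letter `μ` (X1) in
every frame alike — by `tendsto_scaleMeanFieldDensityCT_of_emptyShell_of_bare` the frame is immaterial and only the bare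
Matsubara UV limit (landing at `dWaveSourceTorus L U (μ + U/2) h`) is at stake. [folklore] -/
theorem stub_matsubaraBridge_free :
    ∀ (L : ℕ) [NeZero L] (β μ h Λ' : ℝ) (K' : TrigPolyC4v), 3 ≤ L → 0 < β → 0 < Λ' →
      (∀ k : TorusSite 2 L, Λ' ≤ |nambuXiCT L μ K' k|) →
      Tendsto (fun M : ℕ => scaleMeanFieldDensityCT L M β 0 μ h K' Λ') atTop
        (𝓝 ((Matrix.gibbsState β (dWaveSourceTorus L 0 μ h) (pairField dWaveFormFactor L)).re / (L : ℝ) ^ 2)) :=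
  fun _ _ _ _ h _ _ hL hβ hΛ hshell => tendsto_scaleMeanFieldDensityCT_free_bridge_of_emptyShell hL hβ h hΛ hshell

/-- The same with the shell hypothesis in the un-normed form `Λ′ ≤ e_{K′}(k)` used by the octave-recertification skeleton
(a fully gapped PARTICLE-like frame; it implies the normed form). [folklore] -/
theorem stub_matsubaraBridge_free' :
    ∀ (L : ℕ) [NeZero L] (β μ h Λ' : ℝ) (K' : TrigPolyC4v), 3 ≤ L → 0 < β → 0 < Λ' →
      (∀ k : TorusSite 2 L, Λ' ≤ nambuXiCT L μ K' k) →
      Tendsto (fun M : ℕ => scaleMeanFieldDensityCT L M β 0 μ h K' Λ') atTop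
        (𝓝 ((Matrix.gibbsState β (dWaveSourceTorus L 0 μ h) (pairField dWaveFormFactor L)).re / (L : ℝ) ^ 2)) :=
  fun _ _ _ _ h _ _ hL hβ hΛ hshell =>
    tendsto_scaleMeanFieldDensityCT_free_bridge_of_emptyShell hL hβ h hΛ fun k => (hshell k).trans (le_abs_self _)

end Summit.HubbardSuperconductivity.HubbardSuperconductivity.Theorems
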